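import Mathlib
import HarnessLib
import Literature.Analysis.FluidPDE.PressureRepresentation
import Summits.NavierStokesRegularity.NavierStokesRegularity.Theorems.RellichScarSymmetricScarExistsApexRieszPressureBounds

/-!
# Route `LocalPressureProfileDoor` (door S17⁺), crux K1 `LocalPointZoomSimilarityPressure`
# (stmt-NavierStokesRegularity-20181) — helper 1: covariance of the Riesz pressure potential and the 2-jet calculus
# of the quadratic source

Seat `ns-pressure-K1-p1` (`--supports stmt-NavierStokesRegularity-20181`).  Bookkeeping for the slice-wise convergence
of the Riesz pressure `Q[v] = pressurePotential v` along a parabolic point zoom: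

* `pressureSource_comp_add`, `nearPotential_comp_add`, `farPotential_comp_add`, `pressurePotential_comp_add` —
  translation covariance `Q[W(x₀ + ·)](ξ) = Q[W](x₀ + ξ)` (no hypotheses: derivatives and Lebesgue measure are
  translation invariant);
* `pressurePotential_zoom_of_integrable` — dilation covariance `Q[a • W(b ·)](ξ) = a² Q[W](b ξ)` for the FINITE-ENERGY
  class `W ∈ C²`, `|W|² ∈ L¹` (the tree's `pressurePotential_zoom` is the decay-class twin; both rest on the cutoff
  independence, here `pressurePotential_eq_scale`), and the affine form `pressurePotential_smul_comp_affine`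
  `Q[a • W(x₀ + b ·)](ξ) = a² Q[W](x₀ + b ξ)` used to read the similarity pressure of a classical Leray–Hopf slice;
* `pressureSource_eq_jet` — the quadratic source `G[v] = ∂ᵢ∂ⱼ(vᵢvⱼ)` of a `C²` field as a continuous function of the
  2-jet `(v(x), Dv(x), D²v(x))`, and `tendsto_pressureSource_of_tendsto_jet` — pointwise convergence of the sources from
  pointwise convergence of the 2-jets;
* `tendsto_fderiv_fderiv_of_tendsto_iteratedFDeriv_two` — `D²` in the curried form from `iteratedFDeriv ℝ 2`;
* `decay_slice_of_hasTypeIDecay` — a slice of the space–time Type-I class lies in the decay class `C/(1+|y|)`.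

WHAT THIS IS NOT: not a claim about Navier–Stokes regularity; kernel bookkeeping for a CONDITIONAL door's K1.
-/

noncomputable section

-- the summit and its single sub-problem share the name (CONVENTIONS §1), as in every Theorems file
set_option linter.dupNamespace false
-- nested operator types `ℝ³ →L[ℝ] ℝ³ →L[ℝ] ℝ³ →L[ℝ] ℝ`
set_option maxSynthPendingDepth 3

namespace Summit.NavierStokesRegularity.NavierStokesRegularity.Theorems.LocalPressureProfileDoorPressureCovariance

open MeasureTheory Set Function Filter Topology Metric
open Literature.Analysis Literature.Analysis.FluidPDE
open Summit.NavierStokesRegularity.NavierStokesRegularity.Theorems.SymmetricScarExists.LogtimeBernoulli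
  (nearPotential_zoom farPotential_zoom)

/-! ### Translation covariance -/

/-- Translation covariance of the quadratic source: `G[W(x₀ + ·)] = G[W](x₀ + ·)`. -/
theorem pressureSource_comp_add (W : EuclideanSpace ℝ (Fin 3) → EuclideanSpace ℝ (Fin 3))
    (x₀ : EuclideanSpace ℝ (Fin 3)) :
    pressureSource (fun η => W (x₀ + η)) = fun ξ => pressureSource W (x₀ + ξ) := by
  have hD : ∀ η : EuclideanSpace ℝ (Fin 3), fderiv ℝ (fun η => W (x₀ + η)) η = fderiv ℝ W (x₀ + η) :=
    fun η => fderiv_comp_add_left x₀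
  have hYV : (fun η => convect (fun η => W (x₀ + η)) (fun η => W (x₀ + η)) η +
      VectorCalculus.divergence (fun η => W (x₀ + η)) η • (fun η => W (x₀ + η)) η) =
      fun η => (fun ζ => convect W W ζ + VectorCalculus.divergence W ζ • W ζ) (x₀ + η) := by
    funext η
    simp only [convect_apply, divergence_eq_traceCLM, hD]
  rw [pressureSource_def, pressureSource_def, hYV]
  funext ξ
  rw [divergence_eq_traceCLM, divergence_eq_traceCLM]
  congr 1
  exact fderiv_comp_add_left (f := fun ζ => convect W W ζ + VectorCalculus.divergence W ζ • W ζ) x₀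

/-- Translation covariance of the near potential: `Q₁[W(x₀ + ·)](ξ) = Q₁[W](x₀ + ξ)`. -/
theorem nearPotential_comp_add (r₀ r₁ : ℝ) (W : EuclideanSpace ℝ (Fin 3) → EuclideanSpace ℝ (Fin 3))
    (x₀ ξ : EuclideanSpace ℝ (Fin 3)) :
    nearPotential r₀ r₁ (fun η => W (x₀ + η)) ξ = nearPotential r₀ r₁ W (x₀ + ξ) := by
  rw [nearPotential, nearPotential, pressureSource_comp_add]
  refine integral_congr_ae (Eventually.of_forall fun z => ?_)
  dsimp only
  rw [add_sub_assoc]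

/-- Translation covariance of the far potential: `Q₂[W(x₀ + ·)](ξ) = Q₂[W](x₀ + ξ)` (substitute `η' = x₀ + η`). -/
theorem farPotential_comp_add (r₀ r₁ : ℝ) (W : EuclideanSpace ℝ (Fin 3) → EuclideanSpace ℝ (Fin 3))
    (x₀ ξ : EuclideanSpace ℝ (Fin 3)) :
    farPotential r₀ r₁ (fun η => W (x₀ + η)) ξ = farPotential r₀ r₁ W (x₀ + ξ) := by
  rw [farPotential, farPotential, ← integral_add_left_eq_self
    (fun η' => fderiv ℝ (fderiv ℝ (newtonFar r₀ r₁)) (x₀ + ξ - η') (W η') (W η')) x₀]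
  refine integral_congr_ae (Eventually.of_forall fun η => ?_)
  dsimp only
  rw [show x₀ + ξ - (x₀ + η) = ξ - η by abel]

/-- **Translation covariance of the pressure potential**: `Q[W(x₀ + ·)](ξ) = Q[W](x₀ + ξ)`. -/
theorem pressurePotential_comp_add (W : EuclideanSpace ℝ (Fin 3) → EuclideanSpace ℝ (Fin 3))
    (x₀ ξ : EuclideanSpace ℝ (Fin 3)) :
    pressurePotential (fun η => W (x₀ + η)) ξ = pressurePotential W (x₀ + ξ) := by
  rw [pressurePotential, pressurePotential, nearPotential_comp_add, farPotential_comp_add]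

/-! ### Dilation covariance on the finite-energy class -/

/-- **Dilation covariance of the pressure potential on the finite-energy class**: `Q[a • W(b ·)](ξ) = a² Q[W](b ξ)` for
`b > 0`, `W ∈ C²` with `|W|² ∈ L¹` (`nearPotential_zoom`, `farPotential_zoom`, and the cutoff independence
`pressurePotential_eq_scale`). -/
theorem pressurePotential_zoom_of_integrable {W : EuclideanSpace ℝ (Fin 3) → EuclideanSpace ℝ (Fin 3)}
    (hW2 : ContDiff ℝ 2 W) (hL2 : Integrable fun y => ‖W y‖ ^ 2) (a : ℝ) {b : ℝ} (hb : 0 < b)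
    (ξ : EuclideanSpace ℝ (Fin 3)) :
    pressurePotential (fun ξ => a • W (b • ξ)) ξ = a ^ 2 * pressurePotential W (b • ξ) := by
  rw [pressurePotential, nearPotential_zoom W a hb, farPotential_zoom W a hb,
    pressurePotential_eq_scale hb hW2 hL2 (b • ξ)]
  ring

/-- **Affine covariance on the finite-energy class**: `Q[a • W(x₀ + b ·)](ξ) = a² Q[W](x₀ + b ξ)` for `b > 0`,
`W ∈ C²`, `|W|² ∈ L¹` — the similarity pressure of a rescaled classical Leray–Hopf slice. -/
theorem pressurePotential_smul_comp_affine {W : EuclideanSpace ℝ (Fin 3) → EuclideanSpace ℝ (Fin 3)}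
    (hW2 : ContDiff ℝ 2 W) (hL2 : Integrable fun y => ‖W y‖ ^ 2) (a : ℝ) {b : ℝ} (hb : 0 < b)
    (x₀ ξ : EuclideanSpace ℝ (Fin 3)) :
    pressurePotential (fun η => a • W (x₀ + b • η)) ξ = a ^ 2 * pressurePotential W (x₀ + b • ξ) := by
  have h1 : (fun η => a • W (x₀ + b • η)) = fun η => a • (fun ζ => W (x₀ + ζ)) (b • η) := rfl
  have hW2' : ContDiff ℝ 2 (fun ζ => W (x₀ + ζ)) := hW2.comp (contDiff_const.add contDiff_id)
  have hL2' : Integrable fun y => ‖(fun ζ => W (x₀ + ζ)) y‖ ^ 2 := hL2.comp_add_left x₀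
  rw [h1, pressurePotential_zoom_of_integrable hW2' hL2' a hb, pressurePotential_comp_add]

/-! ### The quadratic source as a function of the 2-jet -/

/-- **The quadratic source in terms of the 2-jet**: for `v ∈ C²`,
`G[v](x) = tr(Dv∘Dv) + tr(D²v(·, v)) + tr(D²v(v, ·)) + (tr Dv)²` at `x` (expand `D((v·∇)v) = D²v(·, v) + Dv ∘ Dv`,
`D((div v) v) = D(div v) ⊗ v + (div v) Dv`). -/
theorem pressureSource_eq_jet {v : EuclideanSpace ℝ (Fin 3) → EuclideanSpace ℝ (Fin 3)} (hv : ContDiff ℝ 2 v)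
    (x : EuclideanSpace ℝ (Fin 3)) :
    pressureSource v x =
      traceCLM ((fderiv ℝ v x).comp (fderiv ℝ v x)) + traceCLM ((fderiv ℝ (fderiv ℝ v) x).flip (v x)) +
        (traceCLM (fderiv ℝ (fderiv ℝ v) x (v x)) + traceCLM (fderiv ℝ v x) * traceCLM (fderiv ℝ v x)) := by
  have hv1 : Differentiable ℝ v := hv.differentiable (by simp)
  have hDv : DifferentiableAt ℝ (fderiv ℝ v) x :=
    ((hv.fderiv_right (m := 1) le_rfl).differentiable one_ne_zero) x
  have hdiv : DifferentiableAt ℝ (VectorCalculus.divergence v) x :=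
    ((contDiff_divergence (n := 1) hv).differentiable one_ne_zero) x
  have hY1 : DifferentiableAt ℝ (fun y => fderiv ℝ v y (v y)) x := hDv.clm_apply (hv1 x)
  have hY2 : DifferentiableAt ℝ (fun y => VectorCalculus.divergence v y • v y) x := hdiv.smul (hv1 x)
  rw [pressureSource_def, divergence_eq_traceCLM]
  have h1 : (fun y => convect v v y + VectorCalculus.divergence v y • v y) =
      fun y => fderiv ℝ v y (v y) + VectorCalculus.divergence v y • v y := rfl
  rw [h1, fderiv_fun_add hY1 hY2, map_add, fderiv_clm_apply hDv (hv1 x), map_add,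
    fderiv_fun_smul hdiv (hv1 x), map_add, traceCLM_smulRight, map_smul, smul_eq_mul,
    fderiv_divergence_apply hv, divergence_eq_traceCLM]
  ring

/-- **Pointwise convergence of the quadratic sources from pointwise convergence of the 2-jets**: if at `x` the values,
gradients and (curried) Hessians of the `C²` fields `V j` converge to those of the `C²` field `W`, then
`G[V j](x) → G[W](x)` (the source is a continuous — indeed polynomial — function of the 2-jet). -/
theorem tendsto_pressureSource_of_tendsto_jet {V : ℕ → EuclideanSpace ℝ (Fin 3) → EuclideanSpace ℝ (Fin 3)}
    {W : EuclideanSpace ℝ (Fin 3) → EuclideanSpace ℝ (Fin 3)} (hV : ∀ᶠ j in atTop, ContDiff ℝ 2 (V j))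
    (hW : ContDiff ℝ 2 W) (x : EuclideanSpace ℝ (Fin 3))
    (h0 : Tendsto (fun j => V j x) atTop (𝓝 (W x)))
    (h1 : Tendsto (fun j => fderiv ℝ (V j) x) atTop (𝓝 (fderiv ℝ W x)))
    (h2 : Tendsto (fun j => fderiv ℝ (fderiv ℝ (V j)) x) atTop (𝓝 (fderiv ℝ (fderiv ℝ W) x))) :
    Tendsto (fun j => pressureSource (V j) x) atTop (𝓝 (pressureSource W x)) := by
  -- the jet polynomial as a continuous function of `(a, L, B)`
  set Φ : (EuclideanSpace ℝ (Fin 3) × (EuclideanSpace ℝ (Fin 3) →L[ℝ] EuclideanSpace ℝ (Fin 3))) ×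
      (EuclideanSpace ℝ (Fin 3) →L[ℝ] EuclideanSpace ℝ (Fin 3) →L[ℝ] EuclideanSpace ℝ (Fin 3)) → ℝ :=
    fun J => traceCLM (J.1.2.comp J.1.2) + traceCLM (J.2.flip J.1.1) +
      (traceCLM (J.2 J.1.1) + traceCLM J.1.2 * traceCLM J.1.2) with hΦ
  have hflip : Continuous fun B : EuclideanSpace ℝ (Fin 3) →L[ℝ] EuclideanSpace ℝ (Fin 3) →L[ℝ]
      EuclideanSpace ℝ (Fin 3) => B.flip :=
    (ContinuousLinearMap.flipₗᵢ ℝ (EuclideanSpace ℝ (Fin 3)) (EuclideanSpace ℝ (Fin 3))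
      (EuclideanSpace ℝ (Fin 3))).continuous
  have htr : Continuous (traceCLM : (EuclideanSpace ℝ (Fin 3) →L[ℝ] EuclideanSpace ℝ (Fin 3)) →L[ℝ] ℝ) :=
    ContinuousLinearMap.continuous _
  have hΦc : Continuous Φ := by
    have hL : Continuous fun J : (EuclideanSpace ℝ (Fin 3) × (EuclideanSpace ℝ (Fin 3) →L[ℝ]
        EuclideanSpace ℝ (Fin 3))) × (EuclideanSpace ℝ (Fin 3) →L[ℝ] EuclideanSpace ℝ (Fin 3) →L[ℝ]
        EuclideanSpace ℝ (Fin 3)) => J.1.2 := continuous_snd.comp continuous_fst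
    have ha : Continuous fun J : (EuclideanSpace ℝ (Fin 3) × (EuclideanSpace ℝ (Fin 3) →L[ℝ]
        EuclideanSpace ℝ (Fin 3))) × (EuclideanSpace ℝ (Fin 3) →L[ℝ] EuclideanSpace ℝ (Fin 3) →L[ℝ]
        EuclideanSpace ℝ (Fin 3)) => J.1.1 := continuous_fst.comp continuous_fst
    have hB : Continuous fun J : (EuclideanSpace ℝ (Fin 3) × (EuclideanSpace ℝ (Fin 3) →L[ℝ]
        EuclideanSpace ℝ (Fin 3))) × (EuclideanSpace ℝ (Fin 3) →L[ℝ] EuclideanSpace ℝ (Fin 3) →L[ℝ]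
        EuclideanSpace ℝ (Fin 3)) => J.2 := continuous_snd
    refine ((htr.comp (hL.clm_comp hL)).add (htr.comp ((hflip.comp hB).clm_apply ha))).add
      ((htr.comp (hB.clm_apply ha)).add ((htr.comp hL).mul (htr.comp hL)))
  have hJ : Tendsto (fun j => ((V j x, fderiv ℝ (V j) x), fderiv ℝ (fderiv ℝ (V j)) x)) atTop
      (𝓝 ((W x, fderiv ℝ W x), fderiv ℝ (fderiv ℝ W) x)) := (h0.prodMk_nhds h1).prodMk_nhds h2
  have key := (hΦc.tendsto _).comp hJ
  have eW : Φ ((W x, fderiv ℝ W x), fderiv ℝ (fderiv ℝ W) x) = pressureSource W x := by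
    rw [hΦ, pressureSource_eq_jet hW x]
  rw [eW] at key
  refine key.congr' ?_
  filter_upwards [hV] with j hj
  rw [Function.comp_apply, hΦ, pressureSource_eq_jet hj x]

/-! ### Curried Hessians from `iteratedFDeriv ℝ 2` -/

/-- **Convergence of the curried Hessians from convergence of `iteratedFDeriv ℝ 2`** (for `C²` fields, eventually in
`j`): the difference of the curried Hessians is the curried Hessian of the difference, whose norm is that of the
multilinear one (Mathlib's isometries `norm_iteratedFDeriv_fderiv`, `norm_iteratedFDeriv_zero`). -/
theorem tendsto_fderiv_fderiv_of_tendsto_iteratedFDeriv_two {F : Type*} [NormedAddCommGroup F] [NormedSpace ℝ F]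
    {V : ℕ → EuclideanSpace ℝ (Fin 3) → F} {W : EuclideanSpace ℝ (Fin 3) → F} {x : EuclideanSpace ℝ (Fin 3)}
    (hV : ∀ᶠ j in atTop, ContDiff ℝ 2 (V j)) (hW : ContDiff ℝ 2 W)
    (h2 : Tendsto (fun j => iteratedFDeriv ℝ 2 (V j) x) atTop (𝓝 (iteratedFDeriv ℝ 2 W x))) :
    Tendsto (fun j => fderiv ℝ (fderiv ℝ (V j)) x) atTop (𝓝 (fderiv ℝ (fderiv ℝ W) x)) := by
  rw [tendsto_iff_norm_sub_tendsto_zero] at h2 ⊢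
  refine h2.congr' ?_
  filter_upwards [hV] with j hj
  have hWd : Differentiable ℝ W := hW.differentiable (by simp)
  have hVd : Differentiable ℝ (V j) := hj.differentiable (by simp)
  have hDW : Differentiable ℝ (fderiv ℝ W) := (hW.fderiv_right (m := 1) le_rfl).differentiable one_ne_zero
  have hDV : Differentiable ℝ (fderiv ℝ (V j)) := (hj.fderiv_right (m := 1) le_rfl).differentiable one_ne_zero
  -- `‖D²g(x)‖ = ‖D(Dg)(x)‖` (the tree's `SlicedKelvinPlanarFluxAPriori.norm_fderiv_fderiv_eq_norm_iteratedFDeriv_two`, inlined)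
  rw [← iteratedFDeriv_sub_apply hj.contDiffAt hW.contDiffAt, ← norm_iteratedFDeriv_fderiv,
    ← norm_iteratedFDeriv_fderiv, norm_iteratedFDeriv_zero]
  have hd1 : fderiv ℝ (V j - W) = fderiv ℝ (V j) - fderiv ℝ W := by
    funext y
    exact fderiv_sub (hVd y) (hWd y)
  rw [hd1, fderiv_sub (hDV x) (hDW x)]

/-! ### Slices of the space–time Type-I class are in the decay class -/

/-- A slice `v(s, ·)`, `s < 0`, of a field with the space–time Type-I bound `‖v(s,y)‖ ≤ D/(‖y‖ + √(−s))` obeys the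
decay-class bound `‖v(s,y)‖ ≤ C_s/(1 + ‖y‖)` with `C_s = max D 0 · (1 + (√(−s))⁻¹)`. -/
theorem decay_slice_of_hasTypeIDecay {D : ℝ} {v : ℝ → EuclideanSpace ℝ (Fin 3) → EuclideanSpace ℝ (Fin 3)}
    (hD : HasTypeIDecay D v) {s : ℝ} (hs : s < 0) (y : EuclideanSpace ℝ (Fin 3)) :
    ‖v s y‖ ≤ (max D 0 * (1 + (Real.sqrt (-s))⁻¹)) / (1 + ‖y‖) := by
  have hσ : 0 < Real.sqrt (-s) := Real.sqrt_pos.2 (neg_pos.2 hs)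
  have hden : 0 < ‖y‖ + Real.sqrt (-s) := add_pos_of_nonneg_of_pos (norm_nonneg _) hσ
  have h1 : ‖v s y‖ ≤ max D 0 / (‖y‖ + Real.sqrt (-s)) :=
    (hD s hs y).trans (div_le_div_of_nonneg_right (le_max_left _ _) hden.le)
  refine h1.trans ?_
  rw [div_le_div_iff₀ hden (by positivity)]
  have hkey : 1 + ‖y‖ ≤ (1 + (Real.sqrt (-s))⁻¹) * (‖y‖ + Real.sqrt (-s)) := by
    have e : (1 + (Real.sqrt (-s))⁻¹) * (‖y‖ + Real.sqrt (-s)) =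
        ‖y‖ + Real.sqrt (-s) + (Real.sqrt (-s))⁻¹ * ‖y‖ + 1 := by
      field_simp
      ring
    rw [e]
    nlinarith [norm_nonneg y, hσ.le, mul_nonneg (inv_nonneg.2 hσ.le) (norm_nonneg y)]
  calc max D 0 * (1 + ‖y‖) ≤ max D 0 * ((1 + (Real.sqrt (-s))⁻¹) * (‖y‖ + Real.sqrt (-s))) :=
        mul_le_mul_of_nonneg_left hkey (le_max_right _ _)
    _ = max D 0 * (1 + (Real.sqrt (-s))⁻¹) * (‖y‖ + Real.sqrt (-s)) := by ring

end Summit.NavierStokesRegularity.NavierStokesRegularity.Theorems.LocalPressureProfileDoorPressureCovariance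

end
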